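import Summits.AtomisticToContinuum.Crystallization.Theorems.ChartedZeroExcessLayeredLatticeLiouvilleXT

/-!
# Zero-excess layered lattice Liouville — part XU (lens-2 g59, node «SBGlueD2»): the scheme's inequalities hold below `η₁` and above `R₁`

Critic rows 1133/1135 (part D), leaf (2) `SubWindowBudgetGlueBPG` of `stmt-AtomisticToContinuum-26636`.

★ `SBPre.ok_toK`: for `Q : SBPre` with `Q.OK`, every `0 < η ≤ Q.η₁` and `R ≥ Q.R₁`, the scheme `Q.toK η R` of XM satisfies `SBK.OK` (all sixty
inequalities of the tower: the history budget `hγ` through `δs ≤ ds`, the far-field budgets `hfarA/hfarB/hΘa'/hΘb'` as identities of the `η`-slopes,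
the drift budget from `μM² = cμ2·η ≤ mμ`, the correction sizes from `pmax = cpm·η ≤ mp`, the accumulated mode size `hμsum` from the fixed point
`cμ2 = 16·Cm·cP + 4·Cm·g₀`, `nlo ≥ 4·Cm·g₁`, and the windows `hwin/hτR/hreg/hn0lo` from `R ≥ R₁`, `K_R ≥ 14C₁K_w`); and `SBPre.ABK_toK`:
`(Q.toK η R).ABK = Q.AB·η`.
-/

noncomputable section

open scoped BigOperators
open Set Function Metric

namespace Summit.AtomisticToContinuum.Crystallization.Theorems.ChartedZeroExcessLayeredLatticeLiouville

namespace SBPre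

variable {Q : SBPre} {η R : ℝ}

/-! ### XU.1  The derived constants of `Q.toK η R` -/

/-- `toK_θ₁` (docstring added by the landing lane; see the module docstring). [formal bookkeeping] -/
theorem toK_θ₁ : (Q.toK η R).θ₁ = Q.θ₁ := rfl
/-- `toK_Cm` (docstring added by the landing lane; see the module docstring). [formal bookkeeping] -/
theorem toK_Cm : (Q.toK η R).Cm = Q.Cm := rfl
/-- `toK_Rhist` (docstring added by the landing lane; see the module docstring). [formal bookkeeping] -/
theorem toK_Rhist : (Q.toK η R).Rhist = Q.Rhist := rfl
/-- `toK_G₁` (docstring added by the landing lane; see the module docstring). [formal bookkeeping] -/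
theorem toK_G₁ : (Q.toK η R).G₁ = Q.G₁ := rfl
/-- `toK_pmax` (docstring added by the landing lane; see the module docstring). [formal bookkeeping] -/
theorem toK_pmax : (Q.toK η R).pmax = Q.cpm * η := by
  show Q.cP * η + Q.cG * η / Q.nlo ^ 2 = (Q.cP + Q.cG / Q.nlo ^ 2) * η; ring
/-- `toK_δs` (docstring added by the landing lane; see the module docstring). [formal bookkeeping] -/
theorem toK_δs (hQ : Q.OK) : (Q.toK η R).δs = Q.ds / 2 + 2 * Real.sqrt (Q.cμ2 * η) * (2 * Q.ϱ / Q.c₀) := by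
  show (6 * Q.C₁ * (2 * Q.ϱ / Q.c₀) + 8) * (28 / 25 * Q.ϑ₁ + Q.ϑ₁) + 2 * Real.sqrt (Q.cμ2 * η) * (2 * Q.ϱ / Q.c₀) = _
  rw [ϑ₁_slack hQ]

/-- `sqrt_le_of_le_sq` (docstring added by the landing lane; see the module docstring). [formal bookkeeping] (generic one-liner; kept PRIVATE pre-emptively (dedup gate) — used only in this file) -/
private theorem sqrt_le_of_le_sq {u t : ℝ} (ht : 0 ≤ t) (h : u ≤ t ^ 2) : Real.sqrt u ≤ t :=
  (Real.sqrt_le_sqrt h).trans_eq (Real.sqrt_sq ht)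

/-- `CR_mul_le` (docstring added by the landing lane; see the module docstring). [formal bookkeeping] -/
theorem CR_mul_le (hQ : Q.OK) {s t k : ℝ} (hk : 0 < k) (h : s ≤ t / (k * Q.CR)) : Q.CR * s ≤ t / k := by
  have hCR : 0 < Q.CR := by linarith [hQ.hCR]
  calc Q.CR * s ≤ Q.CR * (t / (k * Q.CR)) := mul_le_mul_of_nonneg_left h hCR.le
    _ = t / k := by field_simp

/-! ### XU.2  Consequences of `η ≤ η₁` -/

section Small

variable (hQ : Q.OK) (hη : 0 < η) (hη₁ : η ≤ Q.η₁)
include hQ hη hη₁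

/-- `μM_le_c₀` (docstring added by the landing lane; see the module docstring). [formal bookkeeping] -/
theorem μM_le_c₀ : Real.sqrt (Q.cμ2 * η) ≤ Q.c₀ / (2 * Q.CR) :=
  sqrt_le_of_le_sq (by have := hQ.hc₀; have := hQ.hCR; positivity)
    ((small_of_le_η₁ hQ hη.le hη₁).1.trans ((min_le_left _ _).trans (min_le_left _ _)))
/-- `μM_le_κ₀` (docstring added by the landing lane; see the module docstring). [formal bookkeeping] -/
theorem μM_le_κ₀ : Real.sqrt (Q.cμ2 * η) ≤ Q.κ₀ / (2 * Q.CR) :=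
  sqrt_le_of_le_sq (by have := hQ.hκ₀; have := hQ.hCR; positivity)
    ((small_of_le_η₁ hQ hη.le hη₁).1.trans ((min_le_left _ _).trans (min_le_right _ _)))
/-- `μM_le_ν` (docstring added by the landing lane; see the module docstring). [formal bookkeeping] -/
theorem μM_le_ν : Real.sqrt (Q.cμ2 * η) ≤ 1 / (2000 * Q.CR) :=
  sqrt_le_of_le_sq (by have := hQ.hCR; positivity)
    ((small_of_le_η₁ hQ hη.le hη₁).1.trans ((min_le_right _ _).trans ((min_le_left _ _).trans (min_le_left _ _))))
/-- `μM_le_tear` (docstring added by the landing lane; see the module docstring). [formal bookkeeping] -/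
theorem μM_le_tear : Real.sqrt (Q.cμ2 * η) ≤ Q.c₀ / 16 :=
  sqrt_le_of_le_sq (by have := hQ.hc₀; positivity)
    ((small_of_le_η₁ hQ hη.le hη₁).1.trans ((min_le_right _ _).trans ((min_le_left _ _).trans (min_le_right _ _))))
/-- `μM_le_ds` (docstring added by the landing lane; see the module docstring). [formal bookkeeping] -/
theorem μM_le_ds : Real.sqrt (Q.cμ2 * η) ≤ Q.ds * Q.c₀ / (8 * Q.ϱ) :=
  sqrt_le_of_le_sq (by have := hQ.hc₀; have := hQ.hds; have := hQ.hϱ; positivity)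
    ((small_of_le_η₁ hQ hη.le hη₁).1.trans ((min_le_right _ _).trans (min_le_right _ _)))

/-- the coherence slack of the scheme is below its target: `δs ≤ ds`. -/
theorem δs_le : (Q.toK η R).δs ≤ Q.ds := by
  rw [toK_δs hQ]
  have hc₀ := hQ.hc₀; have hϱ := hQ.hϱ
  have h := μM_le_ds hQ hη hη₁
  have h2 : 2 * Real.sqrt (Q.cμ2 * η) * (2 * Q.ϱ / Q.c₀) ≤ 2 * (Q.ds * Q.c₀ / (8 * Q.ϱ)) * (2 * Q.ϱ / Q.c₀) :=
    mul_le_mul_of_nonneg_right (by linarith) (by positivity)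
  have e : 2 * (Q.ds * Q.c₀ / (8 * Q.ϱ)) * (2 * Q.ϱ / Q.c₀) = Q.ds / 2 := by field_simp; ring
  linarith

omit hη hη₁ in
/-- `δs_nonneg'` (docstring added by the landing lane; see the module docstring). [formal bookkeeping] -/
theorem δs_nonneg' : 0 ≤ (Q.toK η R).δs := by
  rw [toK_δs hQ]; have := hQ.hds; have := hQ.hϱ; have := hQ.hc₀; positivity

/-- ★ the history budget `hγ`. -/
theorem γ_le : (Q.toK η R).γ * (Q.toK η R).Rhist * (2 + 216 * ((Q.toK η R).k₀ : ℝ) ^ 2 * (Q.toK η R).Cm) ≤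
    (Q.toK η R).θ₁ ^ ((Q.toK η R).k₀ + 1) / 8 := by
  rw [toK_Rhist, toK_Cm, toK_θ₁]
  have hCL := hQ.hCL; have hκ₁ := hQ.hκ₁; have hεf := hQ.hεf; have hεf1 := hQ.hεf1; have hds := hQ.hds; have hds4 := hQ.hds4
  have hCT := hQ.hCT; have hdA := dA_nonneg Q; have hdAϱ := dAϱ_nonneg Q
  have hδ0 := δs_nonneg' (η := η) (R := R) hQ; have hδ1 := δs_le (R := R) hQ hη hη₁
  set d := (Q.toK η R).δs with hd
  have hγ : (Q.toK η R).γ ≤ Q.Bγ := by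
    show (4 + 8 * Q.CL) * (3 / Q.κ₁ ^ 2) * (Q.dA ^ 2 * Q.εf ^ 2 + (1 / 2 * Q.CT * d * Q.dAϱ) ^ 2) ≤ Q.Bγ
    have h1 : Q.dA ^ 2 * Q.εf ^ 2 ≤ (Q.dA ^ 2 + 1) * Q.εf := by
      have : Q.εf ^ 2 ≤ Q.εf := by nlinarith
      nlinarith [mul_le_mul_of_nonneg_left this (sq_nonneg Q.dA)]
    have h2 : (1 / 2 * Q.CT * d * Q.dAϱ) ^ 2 ≤ ((1 / 2 * Q.CT * Q.dAϱ) ^ 2 + 1) * Q.ds := by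
      have hd2 : d ^ 2 ≤ Q.ds := by nlinarith
      have e : (1 / 2 * Q.CT * d * Q.dAϱ) ^ 2 = (1 / 2 * Q.CT * Q.dAϱ) ^ 2 * d ^ 2 := by ring
      rw [e]
      nlinarith [mul_le_mul_of_nonneg_left hd2 (sq_nonneg (1 / 2 * Q.CT * Q.dAϱ))]
    have hA : 0 ≤ (4 + 8 * Q.CL) * (3 / Q.κ₁ ^ 2) := by positivity
    calc (4 + 8 * Q.CL) * (3 / Q.κ₁ ^ 2) * (Q.dA ^ 2 * Q.εf ^ 2 + (1 / 2 * Q.CT * d * Q.dAϱ) ^ 2)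
        ≤ (4 + 8 * Q.CL) * (3 / Q.κ₁ ^ 2) * ((Q.dA ^ 2 + 1) * Q.εf + ((1 / 2 * Q.CT * Q.dAϱ) ^ 2 + 1) * Q.ds) :=
          mul_le_mul_of_nonneg_left (add_le_add h1 h2) hA
      _ = (4 + 8 * Q.CL) * (3 / Q.κ₁ ^ 2) * (Q.dA ^ 2 + 1) * Q.εf + (4 + 8 * Q.CL) * (3 / Q.κ₁ ^ 2) * ((1 / 2 * Q.CT * Q.dAϱ) ^ 2 + 1) * Q.ds := by
          ring
      _ ≤ Q.Bγ / 2 + Q.Bγ / 2 := add_le_add hQ.hεfB hQ.hdsB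
      _ = Q.Bγ := by ring
  have hpos : 0 < 8 * (Q.Rhist * (2 + 216 * (Q.k₀ : ℝ) ^ 2 * Q.Cm)) := by have := Rhist_pos hQ; have := Cm_pos hQ; positivity
  have h := (le_div_iff₀ hpos).1 hγ
  rw [le_div_iff₀ (by norm_num : (0 : ℝ) < 8)]
  show (Q.toK η R).γ * Q.Rhist * (2 + 216 * (Q.k₀ : ℝ) ^ 2 * Q.Cm) * 8 ≤ Q.θ₁ ^ (Q.k₀ + 1)
  calc (Q.toK η R).γ * Q.Rhist * (2 + 216 * (Q.k₀ : ℝ) ^ 2 * Q.Cm) * 8 = (Q.toK η R).γ * (8 * (Q.Rhist * (2 + 216 * (Q.k₀ : ℝ) ^ 2 * Q.Cm))) := by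
        ring
    _ ≤ _ := h

omit hη₁ in
/-- ★ the accumulated mode size `hμsum` (the fixed point `cμ2 = 16·Cm·cP + 4·Cm·g₀`, `nlo ≥ 4·Cm·g₁`). -/
theorem μsum_le : Real.sqrt Q.Cm * (2 * Real.sqrt (Q.cP * η) + Real.sqrt (Q.cG * η) / Q.nlo) ≤ Real.sqrt (Q.cμ2 * η) := by
  have hCm := Cm_pos hQ; have hnlo := hQ.hnlo; have hcP := cP_nonneg hQ; have hcG := cG_nonneg hQ; have hg₀ := g₀_nonneg hQ
  have hg₁ := g₁_nonneg hQ; have hcμ := cμ2_nonneg hQ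
  set u := Real.sqrt (Q.cP * η) with hu
  set v := Real.sqrt (Q.cG * η) / Q.nlo with hv
  have hu0 : 0 ≤ u := Real.sqrt_nonneg _
  have hv0 : 0 ≤ v := by positivity
  have hL0 : 0 ≤ Real.sqrt Q.Cm * (2 * u + v) := by positivity
  have hu2 : u ^ 2 = Q.cP * η := Real.sq_sqrt (by positivity)
  have hv2 : v ^ 2 = Q.cG * η / Q.nlo ^ 2 := by rw [hv, div_pow, Real.sq_sqrt (by positivity)]
  have hsq : (Real.sqrt Q.Cm * (2 * u + v)) ^ 2 ≤ Q.cμ2 * η := by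
    rw [mul_pow, Real.sq_sqrt hCm.le]
    have h1 : (2 * u + v) ^ 2 ≤ 8 * u ^ 2 + 2 * v ^ 2 := by nlinarith [sq_nonneg (2 * u - v)]
    rw [hu2, hv2] at h1
    -- `cG/nlo² ≤ g₀ + cμ2/(4Cm)`
    have hn2 : Q.nlo ≤ Q.nlo ^ 2 := by nlinarith
    have h3 : Q.g₀ / Q.nlo ^ 2 ≤ Q.g₀ := div_le_self hg₀ (by nlinarith)
    have h4 : Q.g₁ * Q.cμ2 / Q.nlo ^ 2 ≤ Q.cμ2 / (4 * Q.Cm) := by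
      rw [div_le_div_iff₀ (by positivity) (by positivity)]
      have := hQ.hnloμ
      have h5 : 4 * Q.Cm * Q.g₁ * Q.cμ2 ≤ Q.nlo * Q.cμ2 := mul_le_mul_of_nonneg_right this hcμ
      nlinarith [mul_le_mul_of_nonneg_right hn2 hcμ]
    have h6 : Q.cG * η / Q.nlo ^ 2 ≤ (Q.g₀ + Q.cμ2 / (4 * Q.Cm)) * η := by
      rw [cG_eq, show (Q.g₀ + Q.g₁ * Q.cμ2) * η / Q.nlo ^ 2 = (Q.g₀ / Q.nlo ^ 2 + Q.g₁ * Q.cμ2 / Q.nlo ^ 2) * η by ring]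
      exact mul_le_mul_of_nonneg_right (add_le_add h3 h4) hη.le
    have e : Q.Cm * (8 * (Q.cP * η) + 2 * ((Q.g₀ + Q.cμ2 / (4 * Q.Cm)) * η)) = Q.cμ2 * η := by
      unfold cμ2; field_simp; ring
    calc Q.Cm * (2 * u + v) ^ 2 ≤ Q.Cm * (8 * (Q.cP * η) + 2 * (Q.cG * η / Q.nlo ^ 2)) := mul_le_mul_of_nonneg_left h1 hCm.le
      _ ≤ Q.Cm * (8 * (Q.cP * η) + 2 * ((Q.g₀ + Q.cμ2 / (4 * Q.Cm)) * η)) := by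
          apply mul_le_mul_of_nonneg_left _ hCm.le; linarith
      _ = Q.cμ2 * η := e
  calc Real.sqrt Q.Cm * (2 * u + v) = Real.sqrt ((Real.sqrt Q.Cm * (2 * u + v)) ^ 2) := (Real.sqrt_sq hL0).symm
    _ ≤ Real.sqrt (Q.cμ2 * η) := Real.sqrt_le_sqrt hsq

/-- the correction sizes: `Cm·pmax ≤ 1/(4CR²)`, `≤ m₀²`, `1728CR²Cm²·pmax ≤ θ₁`. -/
theorem pmax_small : 1728 * Q.CR ^ 2 * Q.Cm ^ 2 * (Q.cpm * η) ≤ Q.θ₁ ∧ Q.Cm * (Q.cpm * η) ≤ Q.m₀ ^ 2 ∧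
    Q.CR * Real.sqrt (Q.Cm * (Q.cpm * η)) + Q.ε ≤ 1 := by
  have hp := (small_of_le_η₁ hQ hη.le hη₁).2
  have hCR := hQ.hCR; have hCm := Cm_pos hQ; have hm₀ := hQ.hm₀; have hε1 := hQ.hε1
  have h1 : Q.cpm * η ≤ Q.θ₁ / (1728 * Q.CR ^ 2 * Q.Cm ^ 2) := hp.trans (min_le_left _ _)
  have h2 : Q.cpm * η ≤ Q.m₀ ^ 2 / Q.Cm := hp.trans ((min_le_right _ _).trans (min_le_left _ _))
  have h3 : Q.cpm * η ≤ 1 / (4 * Q.CR ^ 2 * Q.Cm) := hp.trans ((min_le_right _ _).trans (min_le_right _ _))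
  rw [le_div_iff₀ (by positivity)] at h1 h2 h3
  refine ⟨by linarith, by linarith, ?_⟩
  have h4 : Real.sqrt (Q.Cm * (Q.cpm * η)) ≤ 1 / (2 * Q.CR) := by
    refine sqrt_le_of_le_sq (by positivity) ?_
    rw [show (1 / (2 * Q.CR)) ^ 2 = 1 / (4 * Q.CR ^ 2) by field_simp; ring, le_div_iff₀ (by positivity)]
    linarith
  have h5 : Q.CR * Real.sqrt (Q.Cm * (Q.cpm * η)) ≤ Q.CR * (1 / (2 * Q.CR)) := mul_le_mul_of_nonneg_left h4 (by linarith)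
  have e : Q.CR * (1 / (2 * Q.CR)) = 1 / 2 := by field_simp
  linarith

end Small

/-! ### XU.3  Consequences of `R ≥ R₁` -/

section Large

variable (hQ : Q.OK) (hR : Q.R₁ ≤ R)
include hQ hR

/-- `R_ge` (docstring added by the landing lane; see the module docstring). [formal bookkeeping] -/
theorem R_ge : Q.KR * Q.nlo ≤ R ∧ 32 * Q.ϱ + 40 ≤ R ∧ 4 * (28 / 25 * (24 + 6 * Q.C₁ * (2 * Q.ϱ / Q.c₀) + 6 * Q.C₁)) ≤ R ∧ 1 ≤ R := by
  have h1 : Q.KR * Q.nlo ≤ R := (le_max_left _ _).trans hR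
  have h2 : 32 * Q.ϱ + 40 ≤ R := ((le_max_left _ _).trans (le_max_right _ _)).trans hR
  have h3 : 4 * (28 / 25 * (24 + 6 * Q.C₁ * (2 * Q.ϱ / Q.c₀) + 6 * Q.C₁)) ≤ R := ((le_max_right _ _).trans (le_max_right _ _)).trans hR
  exact ⟨h1, h2, h3, by linarith [hQ.hϱ]⟩

/-- `windows` (docstring added by the landing lane; see the module docstring). [formal bookkeeping] -/
theorem windows : Q.nlo ≤ R / Q.KR ∧
    8 * R + 28 / 25 * (6 * Q.C₁ * (Q.Kw * (R / Q.KR)) + 8) + 28 / 25 * (6 * Q.C₁ * (2 * Q.ϱ / Q.c₀) + 8) + 28 / 25 * (6 * Q.C₁ + 8) ≤ 9 * R ∧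
    14 * Q.C₁ * (R / Q.KR) + 16 * Q.ϱ + 20 ≤ R := by
  obtain ⟨h1, h2, h3, h4⟩ := R_ge hQ hR
  have hKR := KR_pos hQ; obtain ⟨hK1, hK2⟩ := KR_ge hQ; have hC := C₁_pos hQ; have hKw := two_le_Kw hQ; have hc₀ := hQ.hc₀; have hϱ := hQ.hϱ
  refine ⟨by rw [le_div_iff₀ hKR]; linarith, ?_, ?_⟩
  · have ha : 6 * Q.C₁ * (Q.Kw * (R / Q.KR)) ≤ 3 * R / 7 := by
      rw [show 6 * Q.C₁ * (Q.Kw * (R / Q.KR)) = 6 * Q.C₁ * Q.Kw * R / Q.KR by ring, div_le_iff₀ hKR]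
      nlinarith [mul_le_mul_of_nonneg_left hK1 (by linarith : 0 ≤ 3 * R / 7)]
    nlinarith
  · have hb : 14 * Q.C₁ * (R / Q.KR) ≤ R / 2 := by
      rw [show 14 * Q.C₁ * (R / Q.KR) = 14 * Q.C₁ * R / Q.KR by ring, div_le_iff₀ hKR]
      nlinarith [mul_le_mul_of_nonneg_left hK2 (by linarith : 0 ≤ R / 2)]
    linarith

/-- the top registration `hreg`. -/
theorem reg (hη : 0 < η) : dictB Q.C₁ Q.δ * (9 * Q.Cg * η * (2 * (9 * R + 1) / Q.δ + 1) ^ 3) ≤ Q.cP * η * (R / Q.KR) ^ 3 := by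
  obtain ⟨-, -, -, h4⟩ := R_ge hQ hR
  have hδ := hQ.hδ; have hδ1 := hQ.hδ1; have hCg := hQ.hCg; have hKR := KR_pos hQ; have hdB := dictB_nonneg' hQ
  have hb0 : 0 ≤ 2 * (9 * R + 1) / Q.δ + 1 := by positivity
  have hb : 2 * (9 * R + 1) / Q.δ + 1 ≤ 21 * R / Q.δ := by
    rw [div_add_one hδ.ne', div_le_div_iff_of_pos_right hδ]; linarith
  have h3 : (2 * (9 * R + 1) / Q.δ + 1) ^ 3 ≤ (21 * R / Q.δ) ^ 3 := pow_le_pow_left₀ hb0 hb 3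
  calc dictB Q.C₁ Q.δ * (9 * Q.Cg * η * (2 * (9 * R + 1) / Q.δ + 1) ^ 3) ≤ dictB Q.C₁ Q.δ * (9 * Q.Cg * η * (21 * R / Q.δ) ^ 3) :=
        mul_le_mul_of_nonneg_left (mul_le_mul_of_nonneg_left h3 (by positivity)) hdB
    _ = Q.cP * η * (R / Q.KR) ^ 3 := by unfold cP; field_simp

end Large

/-! ### XU.4  The scheme's inequalities -/

/-- ★ `SBK.OK` for the scheme below `η₁` and above `R₁` (module docstring). [this file, g59] -/
theorem ok_toK (hQ : Q.OK) (hη : 0 < η) (hη₁ : η ≤ Q.η₁) (hR : Q.R₁ ≤ R) : (Q.toK η R).OK := by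
  have hc₀ := hQ.hc₀; have hCL := hQ.hCL; have hCR := hQ.hCR; have hδ := hQ.hδ; have hCg := hQ.hCg; have hnlo := hQ.hnlo
  have htC := tC_pos hQ; have htC8 := tC_le hQ; have hC₁ := C₁_pos hQ; have hKR := KR_pos hQ
  have hcP := cP_nonneg hQ; have hcG := cG_nonneg hQ; have hcμ := cμ2_nonneg hQ; have hcΘa := cΘa_nonneg hQ; have hcΘb := cΘb_nonneg hQ
  have hG₁ := G₁_nonneg hQ; have hA₁ := A₁_nonneg hQ
  obtain ⟨hR1, -, -, hR4⟩ := R_ge hQ hR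
  obtain ⟨hn0lo, hwin, hτR⟩ := windows hQ hR
  obtain ⟨hCRs, hm₀s, hLc⟩ := pmax_small hQ hη hη₁
  have hμc := μM_le_c₀ hQ hη hη₁; have hμκ := μM_le_κ₀ hQ hη hη₁; have hμν := μM_le_ν hQ hη hη₁; have hμt := μM_le_tear hQ hη hη₁
  have hdc : Q.CR * Real.sqrt (Q.cμ2 * η) ≤ Q.c₀ / 2 := CR_mul_le hQ (by norm_num) hμc
  have hdκ : Q.CR * Real.sqrt (Q.cμ2 * η) ≤ Q.κ₀ / 2 := CR_mul_le hQ (by norm_num) hμκ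
  have hdν : Q.CR * Real.sqrt (Q.cμ2 * η) ≤ 1 / 2000 := CR_mul_le hQ (by norm_num) hμν
  have hμ2 : Real.sqrt (Q.cμ2 * η) ^ 2 = Q.cμ2 * η := Real.sq_sqrt (by positivity)
  have hθ₀ : 8 * Q.CL * Q.tC ^ 2 ≤ 1 / 8 := by
    unfold tC
    rw [show 8 * Q.CL * (1 / (8 * Q.CL)) ^ 2 = 1 / (8 * Q.CL) by field_simp, div_le_div_iff₀ (by positivity) (by norm_num)]
    linarith
  exact
    { hδ := hQ.hδ, hδ1 := hQ.hδ1, ha := hQ.ha, hCg := hQ.hCg, hη := hη, hR := hR4, hc₀ := hQ.hc₀, hc₀1 := hQ.hc₀1, hcC := hQ.hcC, hκ₀ := hQ.hκ₀,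
      hCL := hQ.hCL, hκ₁ := hQ.hκ₁, hCT := hQ.hCT, htC := htC, htC2 := by show Q.tC ≤ 1 / 2; linarith, hθ₀ := hθ₀, hKw := le_rfl,
      hKwk := hQ.hKwk, hKR := hKR, hεf := hQ.hεf, hε := hQ.hε, hϱ := hQ.hϱ, hAT := hQ.hAT, hm₀ := hQ.hm₀, hCR := hQ.hCR, hn₁ := hQ.hn₁,
      hϑ₁ := ϑ₁_pos hQ, hω₁ := ϑ₁_pos hQ, hP₀ := by show 0 ≤ Q.cP * η; positivity, hG₀ := by show 0 ≤ Q.cG * η; positivity,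
      hμM := Real.sqrt_nonneg _, hΘa := by show 0 ≤ Q.cΘa * η; positivity, hΘb := by show 0 ≤ Q.cΘb * η; positivity, hnlo := hQ.hnlo,
      hγ := γ_le hQ hη hη₁,
      hfarA := by show 16 * Q.tC ^ 2 * (Q.toK η R).G₁ * (Q.cΘa * η) ≤ Q.cG * η; rw [toK_G₁]; unfold cG; exact le_of_eq (by ring),
      hfarB := by
        show 16 * Q.tC ^ 2 * (Q.toK η R).G₁ * (Q.cΘb * η) ≤ Q.cG * η * Q.nlo ^ 2
        rw [toK_G₁]
        have h1 : 32 * Q.tC ^ 2 * Q.G₁ * Q.A₁ ≤ Q.nlo ^ 2 := hQ.hnloB.trans (by nlinarith)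
        have hx : 0 ≤ Q.cG * η := by positivity
        calc 16 * Q.tC ^ 2 * Q.G₁ * (Q.cΘb * η) = 32 * Q.tC ^ 2 * Q.G₁ * Q.A₁ * (Q.cG * η) := by unfold cΘb; ring
          _ ≤ Q.nlo ^ 2 * (Q.cG * η) := mul_le_mul_of_nonneg_right h1 hx
          _ = Q.cG * η * Q.nlo ^ 2 := by ring,
      hεs := hQ.hεs,
      hCRs := by rw [toK_pmax]; exact hCRs, hm₀s := by rw [toK_pmax]; exact hm₀s, hLc := by rw [toK_pmax]; exact hLc,
      hdc := hdc, hdκ := hdκ, hdC := by show Q.CR * Real.sqrt (Q.cμ2 * η) ≤ Q.C₁; linarith [hQ.hcC],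
      hds := by show Q.CR * Real.sqrt (Q.cμ2 * η) ≤ 1 / 50; linarith, hdν := hdν,
      htear := by show 2 * Real.sqrt (Q.cμ2 * η) ≤ Q.c₀ / 8; linarith, hδs4 := (δs_le hQ hη hη₁).trans hQ.hds4,
      hμsum := μsum_le hQ hη,
      hnlo₁ := hQ.hnlo₁, hnlom := hQ.hnlom, hnlot := hQ.hnlot, hn0lo := hn0lo, hwin := hwin, hτR := hτR, hreg := reg hQ hR hη,
      hΘa' := by
        show dictA Q.c₀ 8 * (27 * (336 * Q.C₁ * (24 / (Q.c₀ * Q.tC)) / 25) ^ 3) * (2 * (Q.cP * η) + 54 * (2 * Real.sqrt (Q.cμ2 * η)) ^ 2) +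
            2 * (10 / Q.δ + 1) ^ 3 * (9 * Q.Cg * η) * ((2 * (192 * Q.KR / Q.c₀ + 2) / Q.δ + 1 / 21) * (336 * Q.C₁ / 25)) ^ 3 +
            2 * ((2 * Real.sqrt (Q.cμ2 * η)) * (8 / Q.c₀)) ^ 2 * (10 / Q.δ + 1) ^ 3 ≤ Q.cΘa * η
        rw [show (2 * Real.sqrt (Q.cμ2 * η)) ^ 2 = 4 * (Q.cμ2 * η) by rw [mul_pow, hμ2]; ring,
          show ((2 * Real.sqrt (Q.cμ2 * η)) * (8 / Q.c₀)) ^ 2 = 4 * (Q.cμ2 * η) * (8 / Q.c₀) ^ 2 by rw [mul_pow, mul_pow, hμ2]; ring]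
        unfold cΘa A₁ A₂ A₃
        exact le_of_eq (by ring),
      hΘb' := by
        show dictA Q.c₀ 8 * (27 * (336 * Q.C₁ * (24 / (Q.c₀ * Q.tC)) / 25) ^ 3) * (2 * (Q.cG * η)) ≤ Q.cΘb * η
        unfold cΘb A₁
        exact le_of_eq (by ring) }

/-- ★ the energy constant of the scheme: `K.ABK = AB·η`. -/
theorem ABK_toK (hQ : Q.OK) (hη : 0 ≤ η) : (Q.toK η R).ABK = Q.AB * η := by
  have hμ2 : Real.sqrt (Q.cμ2 * η) ^ 2 = Q.cμ2 * η := Real.sq_sqrt (by have := cμ2_nonneg hQ; positivity)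
  show dictA Q.c₀ 8 * (27 * (336 * Q.C₁ * ((24 / Q.c₀ + 1) / Q.tC) / 25) ^ 3) * (2 * (Q.toK η R).pmax + 54 * (2 * Real.sqrt (Q.cμ2 * η)) ^ 2) +
      2 * (10 / Q.δ + 1) ^ 3 * (8 * Q.Cg * η) * ((2 * (192 * Q.KR / Q.c₀ + 1) / Q.δ + 1 / 21) * (336 * Q.C₁ / 25)) ^ 3 = Q.AB * η
  rw [toK_pmax, show (2 * Real.sqrt (Q.cμ2 * η)) ^ 2 = 4 * (Q.cμ2 * η) by rw [mul_pow, hμ2]; ring]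
  unfold AB
  ring

end SBPre

end Summit.AtomisticToContinuum.Crystallization.Theorems.ChartedZeroExcessLayeredLatticeLiouville

end
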